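import Summits.CriticalPhenomena.SAWScalingLimit.Theses.SAWLoopFugacityFlow
import Summits.CriticalPhenomena.SAWScalingLimit.Theorems.IsingBoundaryRatio.Negative.IsingBoundaryRatioNormalisation
import Literature.Probability.RandomPlanarGeometry.RestrictionHullsHolds

/-!
# `SAWLoopFugacityFlow.SLEAvoidanceValue` (stmt-CriticalPhenomena-10651): the SLE_{8/3} value of
the hull-avoidance probability

Route `SAWLoopFugacityFlow` of `CriticalPhenomena/SAWScalingLimit`, support item
`SLEAvoidanceValue` — G. F. Lawler, O. Schramm, W. Werner, *Conformal restriction: the chordal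
case*, J. Amer. Math. Soc. **16** (2003), Thm. 6.1 (p. 23), transposed to a Dobrushin domain
`(D; a, b)` and a subdomain `D' ⊆ D` with the same marked points agreeing with `D` in ε-balls
around them: for `μ` the chordal SLE_{8/3} law of `D`, `φ` ANY chordal uniformizing map of
`(D; a, b)`, `A = closure (ℍ ∖ φ⁻¹(D'))` the pulled-back hull and `(Φ, d)` restriction data of
`A` (`IsRestrictionMap A Φ`, `HasRestrictionDeriv A Φ d`), `μ {Γ ⊆ closure D'} = d ^ (5/8)`.

## Proof

Everything is in the tree (`Literature/Probability/RandomPlanarGeometry`):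

* the ε-ball clause makes `D'` a hull subdomain (`MarkedDomain.IsHullSubdomain`; the tree's
  `IsingBoundaryRatio.Negative.isHullSubdomain_of_conds`, elementary);
* the inline `A` is `φ.pullbackHull D'` by `rfl`, a `*`-hull (`IsStarHull.pullbackHull`);
* the law `μ = P.map Γ₀` of SOME SLE_{8/3} curve `Γ₀` (with its own uniformizing map) is
  re-realised through the GIVEN `φ`: `exists_isSLECurve_through_of_ae_tendsto` builds the curve
  `Γ` of the compactified `φ`-image of the trace, and uniqueness in law of chordal SLE
  (`IsSLECurve.map_eq_holds`) gives `P.map Γ₀ = P.map Γ`;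
* on a full-measure event, `{γ ∩ A = ∅} ⊆ {Γ ∈ V} ⊆ {γ(0,∞) ⊆ closure (ℍ ∖ A)}` for
  `V = {Γ ⊆ closure D'}` (`disjoint_range_pullbackHull_iff`, `forall_mem_closure_pullbackDomain`),
  and touching `A` without entering is null
  (`measure_subset_closure_le_measure_avoid_of_hasSLETrace`, `HullRestrictionNull`), so
  `μ V = P[γ ∩ A = ∅]` — the `hVEA` step of `IsSLELaw.hullRestriction_eightThirds_of_facts_at`;
* [LSW] Thm. 6.1 in the half-plane, a theorem of the tree (`sle_restriction_eightThirds_holds`),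
  evaluates `P[γ ∩ A = ∅] = d ^ (5/8)` for the GIVEN `(Φ, d)`.
-/

noncomputable section

open Set Filter Topology MeasureTheory
open UpperHalfPlane (upperHalfPlaneSet)
open Literature.Probability Literature.Probability.RandomPlanarGeometry
open scoped NNReal ENNReal

namespace Summit.CriticalPhenomena.SAWScalingLimit.Theorems

/-- **`SLEAvoidanceValue` (stmt-CriticalPhenomena-10651) holds** — [LSW] Thm. 6.1 transposed to
hull subdomains, VALUE form: for `μ` the chordal SLE_{8/3} law of `(D; a, b)`, `D' ⊆ D` with the
same marked points agreeing with `D` near them, `φ` any chordal uniformizing map of `(D; a, b)`,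
`A = closure (ℍ ∖ φ⁻¹(D'))` and restriction data `(Φ, d)` of `A`,
`μ {Γ ⊆ closure D'} = ENNReal.ofReal (d ^ (5/8))`. Proof: re-realise `μ` through the given `φ`
(uniqueness in law of chordal SLE), identify `{Γ ⊆ closure D'}` with `{γ ∩ A = ∅}` up to the
null event "touching without entering" (`HullRestrictionNull`), and evaluate by Thm. 6.1 in the
half-plane (`sle_restriction_eightThirds_holds`).
G. F. Lawler, O. Schramm, W. Werner, J. Amer. Math. Soc. 16 (2003), Thm. 6.1 (p. 23). -/
theorem SLEAvoidanceValue_proof :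
    Summit.CriticalPhenomena.SAWScalingLimit.Theses.SAWLoopFugacityFlow.SLEAvoidanceValue := by
  classical
  unfold Summit.CriticalPhenomena.SAWScalingLimit.Theses.SAWLoopFugacityFlow.SLEAvoidanceValue
  intro D D' μ hμ hsub h0 h1 hε φ hφ A hA Φ d hΦ hd
  subst hA
  -- the inline hull is the pulled-back hull, by `rfl`
  change ConformalEquiv (upperHalfPlaneSet \ φ.pullbackHull D') upperHalfPlaneSet at Φ
  change IsRestrictionMap (φ.pullbackHull D') Φ at hΦ
  change HasRestrictionDeriv (φ.pullbackHull D') Φ d at hd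
  -- inputs, all theorems of the tree
  have h61 : sle_restriction_eightThirds := sle_restriction_eightThirds_holds
  have hκt : HasSLETrace ((8 : ℝ≥0) / 3) := hasSLETrace_eightThirds
  have hsc : ∀ D : JordanDomain, D.isSimplyConnected := JordanDomain.isSimplyConnected_holds
  have hC : JordanDomain.exists_continuousOn_extension :=
    JordanDomain.exists_continuousOn_extension_holds
  have hext : JordanDomain.continuousOn_boundaryExtension :=
    JordanDomain.continuousOn_boundaryExtension_of_disc hC
  have hmeas : aemeasurable_sleTrace := aemeasurable_sleTrace_holds
  have htr := tendsto_norm_sleTrace_atTop_eightThirds_of_hasSLETrace hκt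
  have hκ4 : (8 : ℝ≥0) / 3 ≤ 4 := by
    rw [div_le_iff₀ (by norm_num : (0 : ℝ≥0) < 3)]
    norm_num
  have hsimple : ∀ᵐ ω ∂Process.preWienerMeasure,
      Loewner.IsSimpleTrace (sleTrace ((8 : ℝ≥0) / 3) ω) :=
    ae_isSimpleTrace_sleTrace_of_hasSLETrace hκt hκ4
  -- the hull subdomain and its pulled-back `*`-hull
  have hD' : D.IsHullSubdomain D' :=
    IsingBoundaryRatio.Negative.isHullSubdomain_of_conds hsub h0 h1 hε
  have hA : IsStarHull (φ.pullbackHull D') := IsStarHull.pullbackHull hsc hφ hD'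
  -- the law `μ` realised through the GIVEN uniformizing map `φ`
  obtain ⟨Γ₀, hΓ₀, rfl⟩ := hμ
  obtain ⟨Γ, hΓm, hΓae⟩ := exists_isSLECurve_through_of_ae_tendsto hκt htr hext (hmeas hκt) hφ
  have hlaw : Process.preWienerMeasure.map Γ₀ = Process.preWienerMeasure.map Γ :=
    IsSLECurve.map_eq_holds hΓ₀ (IsSLECurve.of_through hφ hΓm hΓae)
  rw [hlaw]
  -- the event and the key a.s. implications
  set V : Set (CurveClass ℂ) := CurveClass.rangeSubset (closure D'.carrier) with hVdef
  have hVm : MeasurableSet V := CurveClass.measurableSet_rangeSubset isClosed_closure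
  have hkey : ∀ᵐ ω ∂Process.preWienerMeasure,
      (Disjoint (range (sleTrace ((8 : ℝ≥0) / 3) ω)) (φ.pullbackHull D') → Γ ω ∈ V) ∧
      (Γ ω ∈ V → ∀ t, 0 < t →
        sleTrace ((8 : ℝ≥0) / 3) ω t ∈ closure (φ.pullbackDomain D')) := by
    filter_upwards [hΓae, hsimple] with ω ⟨_, c, hΓω, hc⟩ hs
    have h0 : sleTrace ((8 : ℝ≥0) / 3) ω 0 = 0 := sleTrace_zero _ ω
    rw [hΓω]
    refine ⟨fun hr ↦ ?_, fun hV ↦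
      forall_mem_closure_pullbackDomain hD'.carrier_subset hs.2 hc hV⟩
    rw [disjoint_range_pullbackHull_iff hφ hD' h0 hs.2 hc] at hr
    exact subset_closure_of_subset_carrier_union hr
  -- `μ V = P[γ ∩ A = ∅]` (touching without entering is null, `HullRestrictionNull`)
  have hT6 := measure_subset_closure_le_measure_avoid_of_hasSLETrace hφ hD' h61 hκt
  have hmapV : Process.preWienerMeasure.map Γ V = Process.preWienerMeasure (Γ ⁻¹' V) :=
    Measure.map_apply_of_aemeasurable hΓm hVm
  have hle1 : Process.preWienerMeasure (Γ ⁻¹' V) ≤ Process.preWienerMeasure {ω | ∀ t, 0 < t →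
      sleTrace ((8 : ℝ≥0) / 3) ω t ∈ closure (φ.pullbackDomain D')} :=
    measure_mono_ae (hkey.mono fun ω hω hV ↦ hω.2 hV)
  have hle2 : Process.preWienerMeasure {ω | Disjoint (range (sleTrace ((8 : ℝ≥0) / 3) ω))
      (φ.pullbackHull D')} ≤ Process.preWienerMeasure (Γ ⁻¹' V) :=
    measure_mono_ae (hkey.mono fun ω hω hE ↦ hω.1 hE)
  have hVEA : Process.preWienerMeasure.map Γ V =
      Process.preWienerMeasure {ω | Disjoint (range (sleTrace ((8 : ℝ≥0) / 3) ω))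
        (φ.pullbackHull D')} := by
    rw [hmapV]
    exact le_antisymm (hle1.trans hT6) hle2
  -- [LSW] Thm. 6.1 in the half-plane for the GIVEN restriction data `(Φ, d)`
  rw [hVEA]
  exact h61 hA hΦ hd

end Summit.CriticalPhenomena.SAWScalingLimit.Theorems

end
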